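import Summits.CriticalPhenomena.PercolationContinuityZ3.Theorems.PercNearOneGluingNoHeavyLowerTailSahiCombTriWAndMaj3
import Summits.CriticalPhenomena.PercolationContinuityZ3.Theorems.PercNearOneGluingNoHeavyLowerTailSahiCombTriWAndComm

/-!
# AND-products pass every ONE-BLOCK Kleitman test: `Cor_{P₁ ∧ Q}(A₁ × 2^{γ₂}, B) ≥ 0` for every good `P₁`, EVERY up-set `Q`, every `B`

Support file of the one-cut programme (crux `NoHeavyLowerTail`, stmt-CriticalPhenomena-4575; unit `prim-lf-1` gen 60).
Continuation of `…SahiCombTriWAndProd` (the typed conjecture `AndShellLower` / (II): "`P₁ ∧ Q` is an intersecting Kleitman shell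
whenever `P₁` and `Q` are"), of the block theorems `…TriWAndMaj3`, `…AndClaw*`, `…AndPerfect4`, `…AndQ311`, and of `…TriWAndComm`.

All landed block theorems certify `Cor_{P₁ ∧ Q}(A,B) ≥ 0` for ONE block `Q` and all test pairs `(A,B)`.  This file proves a statement that is
uniform in BOTH factors but restricts the TEST: if the up-set `A` depends on the coordinates of one block only — `A = andProd A₁ univ`
(`t ∈ A ↔ t.toLeft ∈ A₁`) or `A = andProd univ A₂` — then `Cor_{P₁ ∧ Q}(A,B) ≥ 0` for EVERY up-set `B` of the product cube:
* **`corP_andProd_oneBlockLeft_nonneg`**: `P₁` an antipode-free up-set with `Cor_{P₁} ≥ 0` (an intersecting Kleitman shell), `Q` ANY up-set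
  (no shell hypothesis on `Q`), `A₁ ⊆ 2^{γ₁}` and `B ⊆ 2^{γ₁ ⊕ γ₂}` up-sets ⟹ `0 ≤ corP (andProd P₁ Q) (andProd A₁ univ) B`;
* **`corP_andProd_oneBlockRight_nonneg`**: `P₁` ANY up-set, `Q` an antipode-free up-set with `Cor_Q ≥ 0` ⟹
  `0 ≤ corP (andProd P₁ Q) (andProd univ A₂) B` (from the left version by the block swap of `…TriWAndComm`);
  `…_right` variants put the one-block set in the second slot (`corP_comm`), `…_of_klShell` variants take the shell hypothesis.
So every possible violation of (II) has BOTH test sets depending on both blocks; in the facet language of the lineage memos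
(gen 55 §13–14) every facet of the shell cone with a one-block member is automatic for AND-products — this extends the "dictator facets are
free" lemma (member `x_a`) to arbitrary one-block members (e.g. `maj3`, `perfect4` of one block against anything).

Proof.  Row decomposition `Cor = Σ_{x∈P₁} σ_{A₁}(x)·β_B(x)` (`corP_andProd_eq_sum_sum`, `sgnDiff_oneBlockLeft`) with the ROW SUM
`β_B(x) = Σ_{y∈Q} ([x⊔y ∈ B] − [xᶜ⊔yᶜ ∈ B])` (lemmas `rowSum_*`; no new definition).  `β_B` is increasing on `2^{γ₁}`, `|β_B| ≤ #Q`,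
and — the point — satisfies the PAIR CONDITION `β_B(x) + β_B(x') ≥ 0` whenever `x ∪ x' = ⊤` (`rowSum_pair`): after two monotonicity
steps this is the sum of the two Kleitman inequalities `#(refl S ∩ Q) ≤ #(S ∩ Q)` for the right sections `S = secR B xᶜ`, `secR B x'ᶜ` (up-sets)
against the up-set `Q`.  Hence `β_B` is an integer `K`-vector on `P₁` and `Σ_{x∈P₁} σ_{A₁} β_B ≥ 0` by the acuteness of `P₁`
(`sum_mul_nonneg_of_unit_of_bounded`: the `{−1,0,1}`-tool `sum_mul_nonneg_of_unit` of `…TriWAndMaj3` extended to a bounded integer partner by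
peeling sign layers).
HONEST LABEL: complete proofs, std axioms; a new unconditional stratum of (II)/`AndShellLower` (all one-block tests, all sizes, both factors
general); the two-block tests — the whole remaining content of (II) — stay OPEN. [this work]
-/

namespace Summit.CriticalPhenomena.PercolationContinuityZ3.Theorems

namespace FiveUpSet

open Finset

variable {γ₁ γ₂ : Type} [DecidableEq γ₁] [Fintype γ₁] [DecidableEq γ₂] [Fintype γ₂]

/-! ### Peeling sign layers: acuteness against a bounded integer `K`-vector -/

omit [DecidableEq γ₁] [Fintype γ₁] in
/-- Values of the sign layer. [this work] -/
theorem layer1_val (k : Finset γ₁ → ℤ) (x : Finset γ₁) : layer1 k x = -1 ∨ layer1 k x = 0 ∨ layer1 k x = 1 := by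
  unfold layer1; split_ifs <;> simp

omit [DecidableEq γ₁] [Fintype γ₁] in
/-- The sign layer of an increasing vector is increasing. [this work] -/
theorem layer1_mono {k : Finset γ₁ → ℤ} {x x' : Finset γ₁} (h : k x ≤ k x') : layer1 k x ≤ layer1 k x' := by
  unfold layer1; split_ifs <;> omega

omit [DecidableEq γ₁] [Fintype γ₁] in
/-- The sign layer inherits the pair condition. [this work] -/
theorem layer1_pair {k : Finset γ₁ → ℤ} {x x' : Finset γ₁} (h : 0 ≤ k x + k x') : 0 ≤ layer1 k x + layer1 k x' := by
  unfold layer1; split_ifs <;> omega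

omit [DecidableEq γ₁] [Fintype γ₁] in
/-- Peeling the sign layer keeps monotonicity. [this work] -/
theorem sub_layer1_mono {k : Finset γ₁ → ℤ} {x x' : Finset γ₁} (h : k x ≤ k x') : k x - layer1 k x ≤ k x' - layer1 k x' := by
  unfold layer1; split_ifs <;> omega

omit [DecidableEq γ₁] [Fintype γ₁] in
/-- Peeling the sign layer keeps the pair condition. [this work] -/
theorem sub_layer1_pair {k : Finset γ₁ → ℤ} {x x' : Finset γ₁} (h : 0 ≤ k x + k x') :
    0 ≤ (k x - layer1 k x) + (k x' - layer1 k x') := by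
  unfold layer1; split_ifs <;> omega

omit [DecidableEq γ₁] [Fintype γ₁] in
/-- Peeling the sign layer lowers the bound by one. [this work] -/
theorem sub_layer1_bounds {k : Finset γ₁ → ℤ} {x : Finset γ₁} {m : ℕ} (h : -((m + 1 : ℕ) : ℤ) ≤ k x ∧ k x ≤ ((m + 1 : ℕ) : ℤ)) :
    -(m : ℤ) ≤ k x - layer1 k x ∧ k x - layer1 k x ≤ (m : ℤ) := by
  push_cast at h
  unfold layer1; split_ifs <;> omega

/-- **Acuteness against a bounded integer `K`-vector.**  On an antipode-free up-set `P₁` with `Cor_{P₁} ≥ 0`, an increasing `{−1,0,1}`-valued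
vector `w` with the pair condition and an increasing INTEGER vector `k` with values in `[-m, m]` and the pair condition have non-negative inner
product over `P₁` (induction on `m`, peeling the sign layer of `k`; `m ≤ 2` is `sum_mul_nonneg_of_two`). [this work] -/
theorem sum_mul_nonneg_of_unit_of_bounded {P₁ : Finset (Finset γ₁)} (hP : IsUpperSet (P₁ : Set (Finset γ₁))) (hd : Disjoint P₁ (refl P₁))
    (hcor : ∀ U V : Finset (Finset γ₁), IsUpperSet (U : Set (Finset γ₁)) → IsUpperSet (V : Set (Finset γ₁)) → 0 ≤ corP P₁ U V)
    (w : Finset γ₁ → ℤ) (hval : ∀ x ∈ P₁, w x = -1 ∨ w x = 0 ∨ w x = 1)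
    (hmono : ∀ x ∈ P₁, ∀ x' ∈ P₁, x ⊆ x' → w x ≤ w x') (hpair : ∀ x ∈ P₁, ∀ x' ∈ P₁, x ∪ x' = univ → 0 ≤ w x + w x') :
    ∀ (m : ℕ) (k : Finset γ₁ → ℤ), (∀ x ∈ P₁, -(m : ℤ) ≤ k x ∧ k x ≤ m) →
      (∀ x ∈ P₁, ∀ x' ∈ P₁, x ⊆ x' → k x ≤ k x') → (∀ x ∈ P₁, ∀ x' ∈ P₁, x ∪ x' = univ → 0 ≤ k x + k x') →
      0 ≤ ∑ x ∈ P₁, w x * k x := by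
  intro m
  induction m with
  | zero =>
    intro k hb _ _
    have h0 : ∑ x ∈ P₁, w x * k x = 0 := by
      refine sum_eq_zero fun x hx => ?_
      have := hb x hx
      have hk : k x = 0 := by push_cast at this; omega
      rw [hk, mul_zero]
    rw [h0]
  | succ m ih =>
    intro k hb hkm hkp
    have hsplit : ∑ x ∈ P₁, w x * k x = ∑ x ∈ P₁, w x * layer1 k x + ∑ x ∈ P₁, w x * (k x - layer1 k x) := by
      rw [← sum_add_distrib]
      exact sum_congr rfl fun x _ => by ring
    rw [hsplit]
    have t1 := sum_mul_nonneg_of_unit hP hd hcor w (layer1 k) hval (fun x _ => layer1_val k x) hmono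
      (fun x hx x' hx' h => layer1_mono (hkm x hx x' hx' h)) hpair (fun x hx x' hx' h => layer1_pair (hkp x hx x' hx' h))
    have t2 := ih (fun x => k x - layer1 k x) (fun x hx => sub_layer1_bounds (hb x hx))
      (fun x hx x' hx' h => sub_layer1_mono (hkm x hx x' hx' h)) (fun x hx x' hx' h => sub_layer1_pair (hkp x hx x' hx' h))
    linarith

/-! ### The row sum `β_B(x) = Σ_{y∈Q} δ_B(x⊔y)` of a family over the block `Q` -/

/-- The row sum as a sum of indicator differences `[x⊔y ∈ B] − [xᶜ⊔yᶜ ∈ B]`. [this work] -/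
theorem rowSum_eq (B : Finset (Finset (γ₁ ⊕ γ₂))) (Q : Finset (Finset γ₂)) (x : Finset γ₁) :
    ∑ y ∈ Q, sgnDiff B (refl B) (x.disjSum y) = ∑ y ∈ Q, (ind B (x.disjSum y) - ind B (xᶜ.disjSum yᶜ)) :=
  sum_congr rfl fun y _ => by rw [sgnDiff_refl_eq, compl_disjSum]

omit [Fintype γ₁] in
/-- `Σ_{y∈Q} [z⊔y ∈ B] = #(secR B z ∩ Q)`. [this work] -/
theorem sum_ind_disjSum_eq_card (B : Finset (Finset (γ₁ ⊕ γ₂))) (Q : Finset (Finset γ₂)) (z : Finset γ₁) :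
    ∑ y ∈ Q, ind B (z.disjSum y) = ((secR B z ∩ Q).card : ℤ) := by
  unfold ind
  rw [sum_boole]
  congr 2
  ext y
  simp only [mem_filter, mem_inter, mem_secR]
  exact and_comm

omit [Fintype γ₁] in
/-- `Σ_{y∈Q} [z⊔yᶜ ∈ B] = #(refl (secR B z) ∩ Q)`. [this work] -/
theorem sum_ind_disjSum_compl_eq_card (B : Finset (Finset (γ₁ ⊕ γ₂))) (Q : Finset (Finset γ₂)) (z : Finset γ₁) :
    ∑ y ∈ Q, ind B (z.disjSum yᶜ) = ((refl (secR B z) ∩ Q).card : ℤ) := by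
  unfold ind
  rw [sum_boole]
  congr 2
  ext y
  simp only [mem_filter, mem_inter, mem_refl, mem_secR]
  exact and_comm

omit [Fintype γ₁] in
/-- **Kleitman on a row**: for up-sets `B` and `Q`, `Σ_{y∈Q} ([z⊔y ∈ B] − [z⊔yᶜ ∈ B]) ≥ 0` — the section `secR B z` is an up-set and an
up-set meets `Q` at least as often as its antipodal image does. [this work] -/
theorem sum_ind_sub_ind_compl_nonneg {B : Finset (Finset (γ₁ ⊕ γ₂))} (hB : IsUpperSet (B : Set (Finset (γ₁ ⊕ γ₂))))
    {Q : Finset (Finset γ₂)} (hQ : IsUpperSet (Q : Set (Finset γ₂))) (z : Finset γ₁) :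
    0 ≤ ∑ y ∈ Q, (ind B (z.disjSum y) - ind B (z.disjSum yᶜ)) := by
  rw [sum_sub_distrib, sum_ind_disjSum_eq_card, sum_ind_disjSum_compl_eq_card, sub_nonneg]
  exact_mod_cast card_refl_inter_le hQ (isUpperSet_secR hB z)

/-- The row sum is increasing in `x` (for an up-set `B`). [this work] -/
theorem rowSum_mono {B : Finset (Finset (γ₁ ⊕ γ₂))} (hB : IsUpperSet (B : Set (Finset (γ₁ ⊕ γ₂)))) (Q : Finset (Finset γ₂))
    {x x' : Finset γ₁} (h : x ⊆ x') : ∑ y ∈ Q, sgnDiff B (refl B) (x.disjSum y) ≤ ∑ y ∈ Q, sgnDiff B (refl B) (x'.disjSum y) := by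
  rw [rowSum_eq, rowSum_eq]
  refine sum_le_sum fun y _ => ?_
  have h1 := ind_mono_pt hB (disjSum_mono h (le_refl y))
  have h2 := ind_mono_pt hB (disjSum_mono (compl_subset_compl.2 h) (le_refl yᶜ))
  linarith

/-- The row sum has values in `[-#Q, #Q]`. [this work] -/
theorem rowSum_bounds (B : Finset (Finset (γ₁ ⊕ γ₂))) (Q : Finset (Finset γ₂)) (x : Finset γ₁) :
    -(Q.card : ℤ) ≤ ∑ y ∈ Q, sgnDiff B (refl B) (x.disjSum y) ∧ ∑ y ∈ Q, sgnDiff B (refl B) (x.disjSum y) ≤ Q.card := by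
  rw [rowSum_eq]
  constructor
  · have h : ∑ y ∈ Q, (-1 : ℤ) ≤ ∑ y ∈ Q, (ind B (x.disjSum y) - ind B (xᶜ.disjSum yᶜ)) :=
      sum_le_sum fun y _ => by
        have h1 := ind_nonneg_le_one B (x.disjSum y); have h2 := ind_nonneg_le_one B (xᶜ.disjSum yᶜ); linarith
    rw [sum_const, smul_neg, nsmul_one] at h
    exact_mod_cast h
  · have h : ∑ y ∈ Q, (ind B (x.disjSum y) - ind B (xᶜ.disjSum yᶜ)) ≤ ∑ y ∈ Q, (1 : ℤ) :=
      sum_le_sum fun y _ => by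
        have h1 := ind_nonneg_le_one B (x.disjSum y); have h2 := ind_nonneg_le_one B (xᶜ.disjSum yᶜ); linarith
    rw [sum_const, nsmul_one] at h
    exact_mod_cast h

/-- **The pair condition for the row sum**: for up-sets `B ⊆ 2^{γ₁ ⊕ γ₂}` and `Q ⊆ 2^{γ₂}`, `x ∪ x' = ⊤ ⟹ β_B(x) + β_B(x') ≥ 0`.
Two monotonicity steps (`x'ᶜ ⊆ x`, `xᶜ ⊆ x'`) reduce it to the two Kleitman inequalities `sum_ind_sub_ind_compl_nonneg` at `z = x'ᶜ`
and `z = xᶜ`. [this work] -/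
theorem rowSum_pair {B : Finset (Finset (γ₁ ⊕ γ₂))} (hB : IsUpperSet (B : Set (Finset (γ₁ ⊕ γ₂))))
    {Q : Finset (Finset γ₂)} (hQ : IsUpperSet (Q : Set (Finset γ₂))) {x x' : Finset γ₁} (h : x ∪ x' = univ) :
    0 ≤ ∑ y ∈ Q, sgnDiff B (refl B) (x.disjSum y) + ∑ y ∈ Q, sgnDiff B (refl B) (x'.disjSum y) := by
  have hc : xᶜ ⊆ x' := by
    intro a ha; rw [mem_compl] at ha
    have := mem_univ a; rw [← h, mem_union] at this; tauto
  have hc' : x'ᶜ ⊆ x := by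
    intro a ha; rw [mem_compl] at ha
    have := mem_univ a; rw [← h, mem_union] at this; tauto
  rw [rowSum_eq, rowSum_eq, ← sum_add_distrib]
  have key : ∀ y ∈ Q, (ind B (x'ᶜ.disjSum y) - ind B (x'ᶜ.disjSum yᶜ)) + (ind B (xᶜ.disjSum y) - ind B (xᶜ.disjSum yᶜ))
      ≤ (ind B (x.disjSum y) - ind B (xᶜ.disjSum yᶜ)) + (ind B (x'.disjSum y) - ind B (x'ᶜ.disjSum yᶜ)) := by
    intro y _
    have h1 := ind_mono_pt hB (disjSum_mono hc' (le_refl y))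
    have h2 := ind_mono_pt hB (disjSum_mono hc (le_refl y))
    linarith
  have hle := sum_le_sum key
  rw [sum_add_distrib] at hle
  have k1 := sum_ind_sub_ind_compl_nonneg hB hQ x'ᶜ
  have k2 := sum_ind_sub_ind_compl_nonneg hB hQ xᶜ
  linarith

/-! ### Row decomposition of `Cor` over an AND-product and the one-block column -/

/-- **Row decomposition of `Cor` over an AND-product** (any blocks): `Cor_{P₁ ∧ Q}(A,B) = Σ_{x∈P₁} Σ_{y∈Q} δ_A(x⊔y) δ_B(x⊔y)`. [this work] -/
theorem corP_andProd_eq_sum_sum (P₁ : Finset (Finset γ₁)) (Q : Finset (Finset γ₂)) (A B : Finset (Finset (γ₁ ⊕ γ₂))) :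
    corP (andProd P₁ Q) A B = ∑ x ∈ P₁, ∑ y ∈ Q, sgnDiff A (refl A) (x.disjSum y) * sgnDiff B (refl B) (x.disjSum y) := by
  rw [corP_eq_sum, andProd_eq_biUnion, sum_biUnion (pairwiseDisjoint_rows P₁ Q)]
  refine sum_congr rfl fun x _ => ?_
  rw [sum_map]
  rfl

/-- The `δ`-vector of a LEFT one-block set `andProd A₁ univ = {t | t.toLeft ∈ A₁}` is the `δ`-vector of `A₁` read on the left coordinate. [this work] -/
theorem sgnDiff_oneBlockLeft (A₁ : Finset (Finset γ₁)) (x : Finset γ₁) (y : Finset γ₂) :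
    sgnDiff (andProd A₁ (univ : Finset (Finset γ₂))) (refl (andProd A₁ (univ : Finset (Finset γ₂)))) (x.disjSum y)
      = sgnDiff A₁ (refl A₁) x := by
  rw [sgnDiff_refl_eq, sgnDiff_refl_eq, compl_disjSum]
  unfold ind
  simp only [mem_andProd, toLeft_disjSum, toRight_disjSum, mem_univ, and_true]

/-- The `δ`-vector of an up-set is increasing. [this work] -/
theorem sgnDiff_refl_mono {A₁ : Finset (Finset γ₁)} (hA : IsUpperSet (A₁ : Set (Finset γ₁))) {x x' : Finset γ₁} (h : x ⊆ x') :
    sgnDiff A₁ (refl A₁) x ≤ sgnDiff A₁ (refl A₁) x' := by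
  rw [sgnDiff_refl_eq, sgnDiff_refl_eq]
  have h1 := ind_mono_pt hA h
  have h2 := ind_mono_pt hA (compl_subset_compl.2 h)
  linarith

/-- The `δ`-vector of an up-set has values in `{−1,0,1}`. [this work] -/
theorem sgnDiff_refl_val (A₁ : Finset (Finset γ₁)) (x : Finset γ₁) :
    sgnDiff A₁ (refl A₁) x = -1 ∨ sgnDiff A₁ (refl A₁) x = 0 ∨ sgnDiff A₁ (refl A₁) x = 1 := by
  unfold sgnDiff; split_ifs <;> simp

/-- The `δ`-vector of an up-set satisfies the pair condition `x ∪ x' = ⊤ ⟹ δ(x) + δ(x') ≥ 0`. [this work] -/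
theorem sgnDiff_refl_pair {A₁ : Finset (Finset γ₁)} (hA : IsUpperSet (A₁ : Set (Finset γ₁))) {x x' : Finset γ₁} (h : x ∪ x' = univ) :
    0 ≤ sgnDiff A₁ (refl A₁) x + sgnDiff A₁ (refl A₁) x' := by
  have hc : xᶜ ⊆ x' := by
    intro a ha; rw [mem_compl] at ha
    have := mem_univ a; rw [← h, mem_union] at this; tauto
  have hc' : x'ᶜ ⊆ x := by
    intro a ha; rw [mem_compl] at ha
    have := mem_univ a; rw [← h, mem_union] at this; tauto
  rw [sgnDiff_refl_eq, sgnDiff_refl_eq]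
  have h1 := ind_mono_pt hA hc
  have h2 := ind_mono_pt hA hc'
  linarith

/-- **`Cor` against a left one-block set is the inner product of `δ_{A₁}` with the row sum of `B`**:
`Cor_{P₁ ∧ Q}(andProd A₁ univ, B) = Σ_{x∈P₁} δ_{A₁}(x) · β_B(x)`. [this work] -/
theorem corP_andProd_oneBlockLeft_eq (P₁ : Finset (Finset γ₁)) (Q : Finset (Finset γ₂)) (A₁ : Finset (Finset γ₁))
    (B : Finset (Finset (γ₁ ⊕ γ₂))) :
    corP (andProd P₁ Q) (andProd A₁ univ) B = ∑ x ∈ P₁, sgnDiff A₁ (refl A₁) x * ∑ y ∈ Q, sgnDiff B (refl B) (x.disjSum y) := by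
  rw [corP_andProd_eq_sum_sum]
  refine sum_congr rfl fun x _ => ?_
  rw [mul_sum]
  exact sum_congr rfl fun y _ => by rw [sgnDiff_oneBlockLeft]

/-! ### The theorems -/

/-- **THEOREM (one-block tests, block on the good side).**  Let `P₁` be an antipode-free up-set with `Cor_{P₁} ≥ 0` on all pairs of up-sets,
`Q` ANY up-set of the second block, `A₁` an up-set of the first block and `B` any up-set of the product cube.  Then
`Cor_{P₁ ∧ Q}(andProd A₁ univ, B) ≥ 0`. [this work] -/
theorem corP_andProd_oneBlockLeft_nonneg {P₁ : Finset (Finset γ₁)} (hP : IsUpperSet (P₁ : Set (Finset γ₁))) (hd : Disjoint P₁ (refl P₁))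
    (hcor : ∀ U V : Finset (Finset γ₁), IsUpperSet (U : Set (Finset γ₁)) → IsUpperSet (V : Set (Finset γ₁)) → 0 ≤ corP P₁ U V)
    {Q : Finset (Finset γ₂)} (hQ : IsUpperSet (Q : Set (Finset γ₂)))
    {A₁ : Finset (Finset γ₁)} (hA : IsUpperSet (A₁ : Set (Finset γ₁)))
    {B : Finset (Finset (γ₁ ⊕ γ₂))} (hB : IsUpperSet (B : Set (Finset (γ₁ ⊕ γ₂)))) :
    0 ≤ corP (andProd P₁ Q) (andProd A₁ univ) B := by
  rw [corP_andProd_oneBlockLeft_eq]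
  exact sum_mul_nonneg_of_unit_of_bounded hP hd hcor (sgnDiff A₁ (refl A₁)) (fun x _ => sgnDiff_refl_val A₁ x)
    (fun x _ x' _ h => sgnDiff_refl_mono hA h) (fun x _ x' _ h => sgnDiff_refl_pair hA h)
    Q.card (fun x => ∑ y ∈ Q, sgnDiff B (refl B) (x.disjSum y)) (fun x _ => rowSum_bounds B Q x) (fun x _ x' _ h => rowSum_mono hB Q h)
    (fun x _ x' _ h => rowSum_pair hB hQ h)

/-- The same with the one-block set in the second slot. [this work] -/
theorem corP_andProd_oneBlockLeft_nonneg_right {P₁ : Finset (Finset γ₁)} (hP : IsUpperSet (P₁ : Set (Finset γ₁))) (hd : Disjoint P₁ (refl P₁))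
    (hcor : ∀ U V : Finset (Finset γ₁), IsUpperSet (U : Set (Finset γ₁)) → IsUpperSet (V : Set (Finset γ₁)) → 0 ≤ corP P₁ U V)
    {Q : Finset (Finset γ₂)} (hQ : IsUpperSet (Q : Set (Finset γ₂)))
    {A₁ : Finset (Finset γ₁)} (hA : IsUpperSet (A₁ : Set (Finset γ₁)))
    {B : Finset (Finset (γ₁ ⊕ γ₂))} (hB : IsUpperSet (B : Set (Finset (γ₁ ⊕ γ₂)))) :
    0 ≤ corP (andProd P₁ Q) B (andProd A₁ univ) := by
  rw [corP_comm]
  exact corP_andProd_oneBlockLeft_nonneg hP hd hcor hQ hA hB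

/-- The same with the hypothesis on `P₁` in Kleitman-shell form. [this work] -/
theorem corP_andProd_oneBlockLeft_nonneg_of_klShell {P₁ : Finset (Finset γ₁)} (hP : IsUpperSet (P₁ : Set (Finset γ₁)))
    (hd : Disjoint P₁ (refl P₁)) (hs : KlShell (P₁ ∪ refl P₁))
    {Q : Finset (Finset γ₂)} (hQ : IsUpperSet (Q : Set (Finset γ₂)))
    {A₁ : Finset (Finset γ₁)} (hA : IsUpperSet (A₁ : Set (Finset γ₁)))
    {B : Finset (Finset (γ₁ ⊕ γ₂))} (hB : IsUpperSet (B : Set (Finset (γ₁ ⊕ γ₂)))) :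
    0 ≤ corP (andProd P₁ Q) (andProd A₁ univ) B :=
  corP_andProd_oneBlockLeft_nonneg hP hd (fun U V hU hV => by rw [corP_eq_card_sub_card_of_disjoint hd]; exact hs U V hU hV) hQ hA hB

/-- The block swap carries a right one-block set to a left one-block set. [this work] -/
theorem famMap_sumComm_oneBlockRight (A₂ : Finset (Finset γ₂)) :
    famMap (Equiv.sumComm γ₁ γ₂) (andProd (univ : Finset (Finset γ₁)) A₂) = andProd A₂ (univ : Finset (Finset γ₁)) :=
  famMap_sumComm_andProd univ A₂

/-- **THEOREM (one-block tests, block on the other side).**  Let `P₁` be ANY up-set of the first block, `Q` an antipode-free up-set of the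
second block with `Cor_Q ≥ 0` on all pairs of up-sets, `A₂` an up-set of the second block and `B` any up-set of the product cube.  Then
`Cor_{P₁ ∧ Q}(andProd univ A₂, B) ≥ 0`. [this work] -/
theorem corP_andProd_oneBlockRight_nonneg {P₁ : Finset (Finset γ₁)} (hP : IsUpperSet (P₁ : Set (Finset γ₁)))
    {Q : Finset (Finset γ₂)} (hQ : IsUpperSet (Q : Set (Finset γ₂))) (hdQ : Disjoint Q (refl Q))
    (hcorQ : ∀ U V : Finset (Finset γ₂), IsUpperSet (U : Set (Finset γ₂)) → IsUpperSet (V : Set (Finset γ₂)) → 0 ≤ corP Q U V)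
    {A₂ : Finset (Finset γ₂)} (hA : IsUpperSet (A₂ : Set (Finset γ₂)))
    {B : Finset (Finset (γ₁ ⊕ γ₂))} (hB : IsUpperSet (B : Set (Finset (γ₁ ⊕ γ₂)))) :
    0 ≤ corP (andProd P₁ Q) (andProd univ A₂) B := by
  rw [← corP_famMap (Equiv.sumComm γ₁ γ₂), famMap_sumComm_andProd, famMap_sumComm_oneBlockRight]
  exact corP_andProd_oneBlockLeft_nonneg hQ hdQ hcorQ hP hA (isUpperSet_famMap _ hB)

/-- The same with the one-block set in the second slot. [this work] -/
theorem corP_andProd_oneBlockRight_nonneg_right {P₁ : Finset (Finset γ₁)} (hP : IsUpperSet (P₁ : Set (Finset γ₁)))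
    {Q : Finset (Finset γ₂)} (hQ : IsUpperSet (Q : Set (Finset γ₂))) (hdQ : Disjoint Q (refl Q))
    (hcorQ : ∀ U V : Finset (Finset γ₂), IsUpperSet (U : Set (Finset γ₂)) → IsUpperSet (V : Set (Finset γ₂)) → 0 ≤ corP Q U V)
    {A₂ : Finset (Finset γ₂)} (hA : IsUpperSet (A₂ : Set (Finset γ₂)))
    {B : Finset (Finset (γ₁ ⊕ γ₂))} (hB : IsUpperSet (B : Set (Finset (γ₁ ⊕ γ₂)))) :
    0 ≤ corP (andProd P₁ Q) B (andProd univ A₂) := by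
  rw [corP_comm]
  exact corP_andProd_oneBlockRight_nonneg hP hQ hdQ hcorQ hA hB

/-- The same with the hypothesis on `Q` in Kleitman-shell form. [this work] -/
theorem corP_andProd_oneBlockRight_nonneg_of_klShell {P₁ : Finset (Finset γ₁)} (hP : IsUpperSet (P₁ : Set (Finset γ₁)))
    {Q : Finset (Finset γ₂)} (hQ : IsUpperSet (Q : Set (Finset γ₂))) (hdQ : Disjoint Q (refl Q)) (hsQ : KlShell (Q ∪ refl Q))
    {A₂ : Finset (Finset γ₂)} (hA : IsUpperSet (A₂ : Set (Finset γ₂)))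
    {B : Finset (Finset (γ₁ ⊕ γ₂))} (hB : IsUpperSet (B : Set (Finset (γ₁ ⊕ γ₂)))) :
    0 ≤ corP (andProd P₁ Q) (andProd univ A₂) B :=
  corP_andProd_oneBlockRight_nonneg hP hQ hdQ
    (fun U V hU hV => by rw [corP_eq_card_sub_card_of_disjoint hdQ]; exact hsQ U V hU hV) hA hB

/-- **Both factors good: every one-block test passes on either side**, for all up-sets `A₁, A₂, B`. [this work] -/
theorem corP_andProd_oneBlock_nonneg {P₁ : Finset (Finset γ₁)} (hP : IsUpperSet (P₁ : Set (Finset γ₁))) (hd : Disjoint P₁ (refl P₁))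
    (hcor : ∀ U V : Finset (Finset γ₁), IsUpperSet (U : Set (Finset γ₁)) → IsUpperSet (V : Set (Finset γ₁)) → 0 ≤ corP P₁ U V)
    {Q : Finset (Finset γ₂)} (hQ : IsUpperSet (Q : Set (Finset γ₂))) (hdQ : Disjoint Q (refl Q))
    (hcorQ : ∀ U V : Finset (Finset γ₂), IsUpperSet (U : Set (Finset γ₂)) → IsUpperSet (V : Set (Finset γ₂)) → 0 ≤ corP Q U V)
    {A₁ : Finset (Finset γ₁)} (hA₁ : IsUpperSet (A₁ : Set (Finset γ₁))) {A₂ : Finset (Finset γ₂)} (hA₂ : IsUpperSet (A₂ : Set (Finset γ₂)))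
    {B : Finset (Finset (γ₁ ⊕ γ₂))} (hB : IsUpperSet (B : Set (Finset (γ₁ ⊕ γ₂)))) :
    0 ≤ corP (andProd P₁ Q) (andProd A₁ univ) B ∧ 0 ≤ corP (andProd P₁ Q) B (andProd A₁ univ) ∧
      0 ≤ corP (andProd P₁ Q) (andProd univ A₂) B ∧ 0 ≤ corP (andProd P₁ Q) B (andProd univ A₂) :=
  ⟨corP_andProd_oneBlockLeft_nonneg hP hd hcor hQ hA₁ hB, corP_andProd_oneBlockLeft_nonneg_right hP hd hcor hQ hA₁ hB,
    corP_andProd_oneBlockRight_nonneg hP hQ hdQ hcorQ hA₂ hB, corP_andProd_oneBlockRight_nonneg_right hP hQ hdQ hcorQ hA₂ hB⟩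

end FiveUpSet

end Summit.CriticalPhenomena.PercolationContinuityZ3.Theorems
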